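import Mathlib
import Summits.CriticalPhenomena.CardyFormulaZ2.Theorems.CardyMagicRigidityMagicFormulaTCloseComparisonMatching
import HarnessLib

/-!
# Deterministic comparison of threshold-averaged truncated squared-phase sums of two `d_CN`-close
configurations (crux `MagicFormulaT`, line `Sketch` v10, sub-goal `el_existsLimitA2_of_facts`) — part 1/3

Crux `Summit.CriticalPhenomena.CardyFormulaZ2.Theses.CardyMagicRigidity.MagicFormulaT`
(stmt-CriticalPhenomena-4836), line `Sketch`, skeleton v10, registered sub-goal `el_existsLimitA2_of_facts`
(existence of `lim_{δ→0⁺} E_{1/2}[A₂]`, `A₂ = Σ_u θ_u²`, modulo Camia–Newman + Smirnov–Werner).  This first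
file is the deterministic heart of the Cauchy argument, the exact analogue for the functional
`S_t(c) = Σ_{u ∈ c, diam u ≥ t} θ_u²` (`θ_u = ∫_{int u} f`, a `finsum` over `c.bigLoops t`) of c3's
`stub_closeComparison` for the product weights; registered sub-goal `ela2_closeComparison`.

**Setting** (verbatim the hypotheses of `stub_closeComparison`).  `f` admissible (`|f| ≤ C`, `f = 0` off
`B̄(0,R)`, measurable, `∫ f = 0`); `c, c'` with `LoopConfig.IsClose ε c c'`; RELEVANT loops (meeting
`B̄(0, R+1)`, diameter `≥ η/5`) of `c` and `c'` finitely many (`≤ N₀`), inside the window `B(0, 1/ε)`,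
pairwise `2ε`-separated (ribbon-free); `ε`-sausages of the relevant loops of `c` of area `≤ τ` in `B̄(0,R)`;
`8mε ≤ η`.

**Theorem** (`ela2_closeComparison`).  With `K = C · Leb(B̄(0,R))` (so `|θ_u| ≤ K`,
`abs_nestingPhase_le_mul_volume_closedBall`), the averages over the `m` thresholds
`η_j = η/2 + (j+1)η/(2m) ∈ (η/2, η]` of `S_{η_j}(c)` and `S_{η_j}(c')` differ by at most
`N₀ (2KCτ + 4π²C²η⁴/m)`.

**Proof.**  (1) MATCHING, verbatim from c3 (`cc_pair_rel`, `cc_eq_of_udist_le`, `cc_exists_partner`): the set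
`P` of pairs `(x, y) ∈ c.loops × c'.loops` with `d(x,y) ≤ ε` and one member meeting `B̄(0,R)` with diameter
`≥ η/2` is a partial bijection between relevant loops, `#P ≤ N₀`, covering every loop that can contribute at
a threshold `t ≥ η/2` (a loop with `θ_u ≠ 0` meets `B̄(0,R)`, `nestingPhase_eq_zero_of_disjoint`), so
`S_t(c) = Σ_{(x,y) ∈ P} a_t(x)`, `S_t(c') = Σ_{(x,y) ∈ P} a_t(y)`, `a_t(u) = [t ≤ diam u] θ_u²`
(`ela2_finsum_bigLoops_eq_sum`).  (2) PER PAIR (`ela2_sum_abs_sub_le`): both big: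
`|θ_x² − θ_y²| = |θ_x − θ_y| |θ_x + θ_y| ≤ (Cτ)(2K)` (`abs_nestingPhase_sub_le_of_udist_le`); both small: `0`;
mixed: the big one has `diam ≤ η_j + 2ε ≤ 5η/4`, so `θ² ≤ (πC(5η/4)²)² ≤ 4π²C²η⁴`
(`uva_abs_nestingPhase_le_sq`), and this happens for at most ONE `j` (`cc_threshold_unique`).  Hence
`Σ_j |a_j(x) − a_j(y)| ≤ m · 2KCτ + 4π²C²η⁴`.  (3) SUMS (`ela2_abs_avg_sub_avg_le`): swap the two sums, divide
by `m`.

Everything is proved from tree material (`…CloseComparisonMatching`, `NestingPhaseEstimates`,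
`…UVAssemblyToolkit`); no definition, no cited fact.  Helper names carry the prefix `ela2_`.
-/

noncomputable section

namespace Summit.CriticalPhenomena.CardyFormulaZ2.Cruxes.MagicFormulaT.LineSketch

open MeasureTheory Filter Set Metric
open scoped Real Topology BigOperators ENNReal
open Literature.Probability.RandomPlanarGeometry Literature.Probability.Percolation
  Literature.Probability.LatticeModels

/-! ## §1 Squared-phase bounds for a single loop and for a matched pair -/

section Phase

variable {f : ℂ → ℝ} {R C : ℝ}

/-- The mixed-case bound: a loop of diameter `≤ 5η/4` has `θ_u² ≤ 4π²C²η⁴`. -/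
theorem ela2_sq_nestingPhase_le_of_diam_le (hC : ∀ z, |f z| ≤ C) (hR : ∀ z, R < ‖z‖ → f z = 0)
    {η : ℝ} {u : UnbasedLoop ℂ} (hu : diam u.range ≤ 5 * η / 4) :
    u.nestingPhase f ^ 2 ≤ 4 * π ^ 2 * C ^ 2 * η ^ 4 := by
  have hC0 : 0 ≤ C := nonneg_of_abs_le hC
  have hπC : 0 ≤ π * C := mul_nonneg Real.pi_pos.le hC0
  have hd2 : diam u.range ^ 2 ≤ (5 * η / 4) ^ 2 := pow_le_pow_left₀ diam_nonneg hu 2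
  have h1 : |u.nestingPhase f| ≤ 2 * π * C * η ^ 2 :=
    calc |u.nestingPhase f| ≤ π * C * diam u.range ^ 2 := uva_abs_nestingPhase_le_sq hC hR u
      _ ≤ π * C * (5 * η / 4) ^ 2 := by gcongr
      _ ≤ 2 * π * C * η ^ 2 := by nlinarith [mul_nonneg hπC (sq_nonneg η)]
  have h2 : |u.nestingPhase f| ^ 2 ≤ (2 * π * C * η ^ 2) ^ 2 := pow_le_pow_left₀ (abs_nonneg _) h1 2
  rw [sq_abs] at h2
  calc u.nestingPhase f ^ 2 ≤ (2 * π * C * η ^ 2) ^ 2 := h2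
    _ = 4 * π ^ 2 * C ^ 2 * η ^ 4 := by ring

/-- The both-big bound: for `d(x, y) ≤ ε` with the `ε`-sausage of `x` of area `≤ τ` in `B̄(0, R)`,
`|θ_x² − θ_y²| = |θ_x − θ_y| · |θ_x + θ_y| ≤ (Cτ) · 2K`, `K = C · Leb(B̄(0,R))`. -/
theorem ela2_abs_sq_sub_sq_le (hf : Measurable f) (hC : ∀ z, |f z| ≤ C) (hR : ∀ z, R < ‖z‖ → f z = 0)
    {x y : UnbasedLoop ℂ} {ε τ : ℝ} (hxy : x.udist y ≤ ε)
    (hV : volume.real ({z : ℂ | infDist z x.range ≤ ε} ∩ closedBall (0 : ℂ) R) ≤ τ) :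
    |x.nestingPhase f ^ 2 - y.nestingPhase f ^ 2| ≤
      2 * (C * volume.real (closedBall (0 : ℂ) R)) * C * τ := by
  have hC0 : 0 ≤ C := nonneg_of_abs_le hC
  set K : ℝ := C * volume.real (closedBall (0 : ℂ) R) with hKdef
  have hK0 : 0 ≤ K := mul_nonneg hC0 measureReal_nonneg
  have hsub : |x.nestingPhase f - y.nestingPhase f| ≤ C * τ :=
    calc |x.nestingPhase f - y.nestingPhase f|
        ≤ C * volume.real ({z : ℂ | infDist z x.range ≤ ε} ∩ closedBall (0 : ℂ) R) :=
          abs_nestingPhase_sub_le_of_udist_le hf hC hR hxy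
      _ ≤ C * τ := by gcongr
  have hadd : |x.nestingPhase f + y.nestingPhase f| ≤ 2 * K :=
    calc |x.nestingPhase f + y.nestingPhase f| ≤ |x.nestingPhase f| + |y.nestingPhase f| := abs_add_le _ _
      _ ≤ K + K := add_le_add (abs_nestingPhase_le_mul_volume_closedBall hC hR x)
          (abs_nestingPhase_le_mul_volume_closedBall hC hR y)
      _ = 2 * K := by ring
  have hτ : 0 ≤ C * τ := le_trans (abs_nonneg _) hsub
  calc |x.nestingPhase f ^ 2 - y.nestingPhase f ^ 2|
      = |x.nestingPhase f - y.nestingPhase f| * |x.nestingPhase f + y.nestingPhase f| := by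
        rw [← abs_mul]; congr 1; ring
    _ ≤ (C * τ) * (2 * K) := mul_le_mul hsub hadd (abs_nonneg _) hτ
    _ = 2 * K * C * τ := by ring

end Phase

/-! ## §2 Per matched pair: the sum over thresholds of the differences of truncated squared phases -/

section Pair

variable {f : ℂ → ℝ} {R C : ℝ}

/-- **Per-pair estimate.**  For two loops `x, y` at unoriented distance `d(x, y) ≤ ε` whose `ε`-sausage (of `x`)
has area `≤ τ` in `B̄(0, R)`, with `8mε ≤ η`, `0 < m`: the sum over the `m` thresholds `η_j` of
`|a_j(x) − a_j(y)|`, `a_j(u) = [η_j ≤ diam u] θ_u²`, is at most `m · 2KCτ + 4π²C²η⁴`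
(both big: `2KCτ`; both small: `0`; mixed: `≤ 4π²C²η⁴`, at most once by `cc_threshold_unique`). -/
theorem ela2_sum_abs_sub_le (hf : Measurable f) (hC : ∀ z, |f z| ≤ C) (hR : ∀ z, R < ‖z‖ → f z = 0)
    {x y : UnbasedLoop ℂ} {ε η τ : ℝ} {m : ℕ} (hε : 0 < ε) (hm : 0 < m) (hmε : 8 * m * ε ≤ η)
    (hxy : x.udist y ≤ ε)
    (hV : volume.real ({z : ℂ | infDist z x.range ≤ ε} ∩ closedBall (0 : ℂ) R) ≤ τ) :
    ∑ j ∈ Finset.range m,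
      |(if η / 2 + ((j : ℝ) + 1) * η / (2 * m) ≤ diam x.range then x.nestingPhase f ^ 2 else 0) -
        (if η / 2 + ((j : ℝ) + 1) * η / (2 * m) ≤ diam y.range then y.nestingPhase f ^ 2 else 0)| ≤
      m * (2 * (C * volume.real (closedBall (0 : ℂ) R)) * C * τ) + 4 * π ^ 2 * C ^ 2 * η ^ 4 := by
  classical
  have hC0 : 0 ≤ C := nonneg_of_abs_le hC
  have hεη : 8 * ε ≤ η := by
    have : (1 : ℝ) ≤ m := by exact_mod_cast hm
    nlinarith
  have hη : 0 ≤ η := by linarith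
  have hdx : diam x.range ≤ diam y.range + 2 * ε := UnbasedLoop.diam_range_le_of_udist_le x y hxy
  have hdy : diam y.range ≤ diam x.range + 2 * ε :=
    UnbasedLoop.diam_range_le_of_udist_le y x (by rwa [UnbasedLoop.udist_comm])
  have hfac : |x.nestingPhase f ^ 2 - y.nestingPhase f ^ 2| ≤
      2 * (C * volume.real (closedBall (0 : ℂ) R)) * C * τ := ela2_abs_sq_sub_sq_le hf hC hR hxy hV
  have hCτ : 0 ≤ 2 * (C * volume.real (closedBall (0 : ℂ) R)) * C * τ := le_trans (abs_nonneg _) hfac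
  -- the mixed thresholds
  set mixed : ℕ → Prop := fun j ↦
    (η / 2 + ((j : ℝ) + 1) * η / (2 * m) ≤ diam x.range ∧
        ¬ η / 2 + ((j : ℝ) + 1) * η / (2 * m) ≤ diam y.range) ∨
      (¬ η / 2 + ((j : ℝ) + 1) * η / (2 * m) ≤ diam x.range ∧
        η / 2 + ((j : ℝ) + 1) * η / (2 * m) ≤ diam y.range) with hmixed
  have hterm : ∀ j ∈ Finset.range m,
      |(if η / 2 + ((j : ℝ) + 1) * η / (2 * m) ≤ diam x.range then x.nestingPhase f ^ 2 else 0) -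
          (if η / 2 + ((j : ℝ) + 1) * η / (2 * m) ≤ diam y.range then y.nestingPhase f ^ 2 else 0)| ≤
        2 * (C * volume.real (closedBall (0 : ℂ) R)) * C * τ +
          if mixed j then 4 * π ^ 2 * C ^ 2 * η ^ 4 else 0 := by
    intro j hj
    have hTj : η / 2 + ((j : ℝ) + 1) * η / (2 * m) ≤ η := cc_threshold_le hη hj
    have hD : 0 ≤ 4 * π ^ 2 * C ^ 2 * η ^ 4 := by positivity
    by_cases hx : η / 2 + ((j : ℝ) + 1) * η / (2 * m) ≤ diam x.range <;>
      by_cases hy : η / 2 + ((j : ℝ) + 1) * η / (2 * m) ≤ diam y.range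
    · -- both big
      have hnm : ¬ mixed j := by
        rintro (⟨-, h⟩ | ⟨h, -⟩)
        · exact h hy
        · exact h hx
      rw [if_pos hx, if_pos hy, if_neg hnm, add_zero]
      exact hfac
    · -- `x` big, `y` small
      have hmx : mixed j := Or.inl ⟨hx, hy⟩
      rw [if_pos hx, if_neg hy, if_pos hmx, sub_zero, abs_of_nonneg (sq_nonneg _)]
      have hdx' : diam x.range ≤ 5 * η / 4 := by
        push Not at hy
        linarith
      linarith [ela2_sq_nestingPhase_le_of_diam_le (f := f) hC hR hdx']
    · -- `x` small, `y` big
      have hmx : mixed j := Or.inr ⟨hx, hy⟩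
      rw [if_neg hx, if_pos hy, if_pos hmx, zero_sub, abs_neg, abs_of_nonneg (sq_nonneg _)]
      have hdy' : diam y.range ≤ 5 * η / 4 := by
        push Not at hx
        linarith
      linarith [ela2_sq_nestingPhase_le_of_diam_le (f := f) hC hR hdy']
    · -- both small
      have hnm : ¬ mixed j := by
        rintro (⟨h, -⟩ | ⟨-, h⟩)
        · exact hx h
        · exact hy h
      rw [if_neg hx, if_neg hy, if_neg hnm, sub_self, abs_zero, add_zero]
      exact hCτ
  have hcard : ((Finset.range m).filter mixed).card ≤ 1 :=
    Finset.card_le_one.2 fun a ha b hb ↦ by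
      rw [Finset.mem_filter] at ha hb
      exact cc_threshold_unique hε hmε hdx hdy ha.1 ha.2 hb.2
  calc ∑ j ∈ Finset.range m,
        |(if η / 2 + ((j : ℝ) + 1) * η / (2 * m) ≤ diam x.range then x.nestingPhase f ^ 2 else 0) -
          (if η / 2 + ((j : ℝ) + 1) * η / (2 * m) ≤ diam y.range then y.nestingPhase f ^ 2 else 0)|
      ≤ ∑ j ∈ Finset.range m, (2 * (C * volume.real (closedBall (0 : ℂ) R)) * C * τ +
          if mixed j then 4 * π ^ 2 * C ^ 2 * η ^ 4 else 0) := Finset.sum_le_sum hterm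
    _ = m * (2 * (C * volume.real (closedBall (0 : ℂ) R)) * C * τ) +
          4 * π ^ 2 * C ^ 2 * η ^ 4 * ((Finset.range m).filter mixed).card := by
        rw [Finset.sum_add_distrib, Finset.sum_const, Finset.card_range, nsmul_eq_mul,
          ← Finset.sum_filter, Finset.sum_const, nsmul_eq_mul]
        ring
    _ ≤ m * (2 * (C * volume.real (closedBall (0 : ℂ) R)) * C * τ) + 4 * π ^ 2 * C ^ 2 * η ^ 4 * 1 := by
        gcongr
        exact_mod_cast hcard
    _ = m * (2 * (C * volume.real (closedBall (0 : ℂ) R)) * C * τ) + 4 * π ^ 2 * C ^ 2 * η ^ 4 := by ring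

end Pair

/-! ## §3 The truncated squared-phase sum as a finite sum over the matched pairs -/

/-- **`S_t(d) = Σᶠ_{u ∈ d.bigLoops t} θ_u²` at a threshold `t ≥ s` is a finite sum over an injectively labelled
family covering the loops meeting `B̄(0, R)` of diameter `≥ s`**: the other big loops have `θ_u = 0`
(`nestingPhase_eq_zero_of_disjoint`), and the labelled loops of diameter `< t` are given the term `0` by hand. -/
theorem ela2_finsum_bigLoops_eq_sum {ι : Type*} {f : ℂ → ℝ} {R : ℝ} (hR : ∀ z, R < ‖z‖ → f z = 0)
    (h0 : ∫ z, f z = 0) (d : LoopConfig ℂ) (P : Finset ι) (proj : ι → UnbasedLoop ℂ)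
    (hinj : Set.InjOn proj ↑P) (hmem : ∀ p ∈ P, proj p ∈ d.loops) {s t : ℝ} (hst : s ≤ t)
    (hcov : ∀ x ∈ d.loops, (x.range ∩ closedBall (0 : ℂ) R).Nonempty → s ≤ diam x.range →
      ∃ p ∈ P, proj p = x) :
    ∑ᶠ u ∈ d.bigLoops t, u.nestingPhase f ^ 2 =
      ∑ p ∈ P, (if t ≤ diam (proj p).range then (proj p).nestingPhase f ^ 2 else 0) := by
  classical
  rw [finsum_mem_eq_sum_of_inter_support_eq (fun u : UnbasedLoop ℂ ↦ u.nestingPhase f ^ 2)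
      (t := (P.image proj).filter fun u ↦ t ≤ diam u.range) ?_]
  · rw [Finset.sum_filter, Finset.sum_image hinj]
  · ext u
    simp only [mem_inter_iff, Function.mem_support, Finset.coe_filter, Finset.mem_image, mem_setOf_eq,
      LoopConfig.mem_bigLoops_iff]
    constructor
    · rintro ⟨⟨hu, htu⟩, hne⟩
      have hθ : u.nestingPhase f ≠ 0 := fun h ↦ hne (by rw [h]; ring)
      have hR' : (u.range ∩ closedBall (0 : ℂ) R).Nonempty := by
        by_contra h
        exact hθ (nestingPhase_eq_zero_of_disjoint hR h0
          (Set.disjoint_iff_inter_eq_empty.2 (Set.not_nonempty_iff_eq_empty.1 h)))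
      obtain ⟨p, hp, rfl⟩ := hcov u hu hR' (hst.trans htu)
      exact ⟨⟨⟨p, hp, rfl⟩, htu⟩, hne⟩
    · rintro ⟨⟨⟨p, hp, rfl⟩, htu⟩, hne⟩
      exact ⟨⟨hmem p hp, htu⟩, hne⟩

/-! ## §4 Averages of sums -/

/-- **Abstract averaging step for sums.**  If `Σ_{j<m} |a_j(p) − b_j(p)| ≤ mK + D` for every `p ∈ P` and
`#P ≤ N₀`, then `|m⁻¹ Σ_j Σ_p a_j(p) − m⁻¹ Σ_j Σ_p b_j(p)| ≤ N₀ (K + D/m)`. -/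
theorem ela2_abs_avg_sub_avg_le {ι : Type*} (P : Finset ι) {m N₀ : ℕ} (hm : 0 < m)
    (hN : P.card ≤ N₀) (a b : ℕ → ι → ℝ) {K D : ℝ} (hK : 0 ≤ K) (hD : 0 ≤ D)
    (hsum : ∀ p ∈ P, ∑ j ∈ Finset.range m, |a j p - b j p| ≤ m * K + D) :
    |(∑ j ∈ Finset.range m, ∑ p ∈ P, a j p) / m - (∑ j ∈ Finset.range m, ∑ p ∈ P, b j p) / m| ≤
      N₀ * (K + D / m) := by
  have hm' : (0 : ℝ) < m := by exact_mod_cast hm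
  rw [← sub_div, ← Finset.sum_sub_distrib, abs_div, abs_of_pos hm', div_le_iff₀ hm']
  have hcardR : (P.card : ℝ) ≤ N₀ := by exact_mod_cast hN
  have hKD : 0 ≤ m * K + D := by positivity
  calc |∑ j ∈ Finset.range m, (∑ p ∈ P, a j p - ∑ p ∈ P, b j p)|
      ≤ ∑ j ∈ Finset.range m, |∑ p ∈ P, a j p - ∑ p ∈ P, b j p| := Finset.abs_sum_le_sum_abs _ _
    _ ≤ ∑ j ∈ Finset.range m, ∑ p ∈ P, |a j p - b j p| :=
        Finset.sum_le_sum fun j _ ↦ by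
          rw [← Finset.sum_sub_distrib]
          exact Finset.abs_sum_le_sum_abs _ _
    _ = ∑ p ∈ P, ∑ j ∈ Finset.range m, |a j p - b j p| := Finset.sum_comm
    _ ≤ ∑ p ∈ P, (m * K + D) := Finset.sum_le_sum hsum
    _ = P.card * (m * K + D) := by rw [Finset.sum_const, nsmul_eq_mul]
    _ ≤ N₀ * (m * K + D) := mul_le_mul_of_nonneg_right hcardR hKD
    _ = N₀ * (K + D / m) * m := by field_simp

/-! ## §5 Registered sub-goal: the comparison -/

/-- **Sub-goal `ela2_closeComparison` of line `Sketch` v10 (registered): deterministic comparison of the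
threshold-averaged truncated squared-phase sums of two `d_CN`-close configurations** whose relevant loops
(diameter `≥ η/5`, meeting `B̄(0,R+1)`) are finitely many (`≤ N₀`), inside the window `B(0,1/ε)`, pairwise
`2ε`-SEPARATED (ribbon-free), the first configuration having `ε`-sausages of area `≤ τ` in `B̄(0,R)` — verbatim
the hypotheses of `stub_closeComparison`: the averages over the `m` thresholds `η_j = η/2 + (j+1)η/(2m)` of
`Σᶠ_{u ∈ bigLoops η_j} θ_u²` differ by `≤ N₀ (2KCτ + 4π²C²η⁴/m)`, `K = C · Leb(B̄(0,R))`.  See the module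
docstring for the proof. -/
theorem ela2_closeComparison :
    ∀ (f : ℂ → ℝ) (R C : ℝ), Measurable f → (∀ z, |f z| ≤ C) → (∀ z, R < ‖z‖ → f z = 0) → ∫ z, f z = 0 →
    ∀ (c c' : LoopConfig ℂ) (ε η τ : ℝ) (m N₀ : ℕ), 0 < ε → ε ≤ 1 → 0 < η → 8 * m * ε ≤ η → 0 ≤ τ →
    LoopConfig.IsClose ε c c' →
    ({u ∈ c.loops | (u.range ∩ Metric.closedBall (0 : ℂ) (R + 1)).Nonempty ∧
        η / 5 ≤ Metric.diam u.range}.Finite ∧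
      {u ∈ c.loops | (u.range ∩ Metric.closedBall (0 : ℂ) (R + 1)).Nonempty ∧
        η / 5 ≤ Metric.diam u.range}.ncard ≤ N₀) →
    ({u ∈ c'.loops | (u.range ∩ Metric.closedBall (0 : ℂ) (R + 1)).Nonempty ∧
        η / 5 ≤ Metric.diam u.range}.Finite ∧
      {u ∈ c'.loops | (u.range ∩ Metric.closedBall (0 : ℂ) (R + 1)).Nonempty ∧
        η / 5 ≤ Metric.diam u.range}.ncard ≤ N₀) →
    (∀ u ∈ c.loops, (u.range ∩ Metric.closedBall (0 : ℂ) (R + 1)).Nonempty → η / 5 ≤ Metric.diam u.range →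
      u.range ⊆ Metric.ball (0 : ℂ) (1 / ε)) →
    (∀ u ∈ c'.loops, (u.range ∩ Metric.closedBall (0 : ℂ) (R + 1)).Nonempty → η / 5 ≤ Metric.diam u.range →
      u.range ⊆ Metric.ball (0 : ℂ) (1 / ε)) →
    (∀ u ∈ c.loops, ∀ v ∈ c.loops, (u.range ∩ Metric.closedBall (0 : ℂ) (R + 1)).Nonempty →
      (v.range ∩ Metric.closedBall (0 : ℂ) (R + 1)).Nonempty → η / 5 ≤ Metric.diam u.range →
      η / 5 ≤ Metric.diam v.range → u ≠ v → 2 * ε < u.udist v) →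
    (∀ u ∈ c'.loops, ∀ v ∈ c'.loops, (u.range ∩ Metric.closedBall (0 : ℂ) (R + 1)).Nonempty →
      (v.range ∩ Metric.closedBall (0 : ℂ) (R + 1)).Nonempty → η / 5 ≤ Metric.diam u.range →
      η / 5 ≤ Metric.diam v.range → u ≠ v → 2 * ε < u.udist v) →
    (∀ u ∈ c.loops, (u.range ∩ Metric.closedBall (0 : ℂ) (R + 1)).Nonempty → η / 5 ≤ Metric.diam u.range →
      volume.real ({z : ℂ | Metric.infDist z u.range ≤ ε} ∩ Metric.closedBall (0 : ℂ) R) ≤ τ) →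
    |(∑ j ∈ Finset.range m, ∑ᶠ u ∈ c.bigLoops (η / 2 + ((j : ℝ) + 1) * η / (2 * m)), u.nestingPhase f ^ 2) / m -
        (∑ j ∈ Finset.range m, ∑ᶠ u ∈ c'.bigLoops (η / 2 + ((j : ℝ) + 1) * η / (2 * m)),
          u.nestingPhase f ^ 2) / m| ≤
      N₀ * (2 * (C * volume.real (Metric.closedBall (0 : ℂ) R)) * C * τ + 4 * π ^ 2 * C ^ 2 * η ^ 4 / m) := by
  intro f R C hf hC hR h0 c c' ε η τ m N₀ hε hε1 hη hmε hτ hclose hA hA' hwin hwin' hsep hsep' hsaus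
  classical
  have hC0 : 0 ≤ C := nonneg_of_abs_le hC
  have hK0 : 0 ≤ C * volume.real (Metric.closedBall (0 : ℂ) R) := mul_nonneg hC0 measureReal_nonneg
  rcases Nat.eq_zero_or_pos m with rfl | hm
  · simp only [Finset.range_zero, Finset.sum_empty, Nat.cast_zero, div_zero, sub_self, abs_zero, add_zero]
    positivity
  have hm' : (0 : ℝ) < m := by exact_mod_cast hm
  have hεη : 8 * ε ≤ η := by
    have : (1 : ℝ) ≤ m := by exact_mod_cast hm
    nlinarith
  -- the matched pairs `P`
  have hPfin : {p : UnbasedLoop ℂ × UnbasedLoop ℂ | p.1 ∈ c.loops ∧ p.2 ∈ c'.loops ∧ p.1.udist p.2 ≤ ε ∧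
      ((p.1.range ∩ closedBall (0 : ℂ) R).Nonempty ∧ η / 2 ≤ diam p.1.range ∨
        (p.2.range ∩ closedBall (0 : ℂ) R).Nonempty ∧ η / 2 ≤ diam p.2.range)}.Finite := by
    refine (hA.1.prod hA'.1).subset ?_
    rintro ⟨x, y⟩ ⟨hx, hy, hxy, hrel⟩
    have h := cc_pair_rel hε1 hεη hη.le hx hy hxy hrel
    exact Set.mk_mem_prod h.1 h.2
  obtain ⟨P, hP⟩ : ∃ P : Finset (UnbasedLoop ℂ × UnbasedLoop ℂ), ∀ p, p ∈ P ↔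
      p.1 ∈ c.loops ∧ p.2 ∈ c'.loops ∧ p.1.udist p.2 ≤ ε ∧
        ((p.1.range ∩ closedBall (0 : ℂ) R).Nonempty ∧ η / 2 ≤ diam p.1.range ∨
          (p.2.range ∩ closedBall (0 : ℂ) R).Nonempty ∧ η / 2 ≤ diam p.2.range) :=
    ⟨hPfin.toFinset, fun p ↦ by simp only [Set.Finite.mem_toFinset, mem_setOf_eq]⟩
  have hrel : ∀ p ∈ P,
      (p.1 ∈ c.loops ∧ (p.1.range ∩ closedBall (0 : ℂ) (R + 1)).Nonempty ∧ η / 5 ≤ diam p.1.range) ∧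
        (p.2 ∈ c'.loops ∧ (p.2.range ∩ closedBall (0 : ℂ) (R + 1)).Nonempty ∧ η / 5 ≤ diam p.2.range) := by
    intro p hp
    obtain ⟨hx, hy, hxy, hr⟩ := (hP p).1 hp
    exact cc_pair_rel hε1 hεη hη.le hx hy hxy hr
  -- ribbon-freeness: both projections of `P` are injective
  have hinj1 : Set.InjOn Prod.fst (↑P : Set (UnbasedLoop ℂ × UnbasedLoop ℂ)) := by
    intro p hp q hq h
    rw [Finset.mem_coe] at hp hq
    refine Prod.ext h (cc_eq_of_udist_le hsep' (hrel p hp).2 (hrel q hq).2 ((hP p).1 hp).2.2.1 ?_)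
    rw [h]
    exact ((hP q).1 hq).2.2.1
  have hinj2 : Set.InjOn Prod.snd (↑P : Set (UnbasedLoop ℂ × UnbasedLoop ℂ)) := by
    intro p hp q hq h
    rw [Finset.mem_coe] at hp hq
    refine Prod.ext (cc_eq_of_udist_le hsep (hrel p hp).1 (hrel q hq).1 (x := p.2) ?_ ?_) h
    · rw [UnbasedLoop.udist_comm]
      exact ((hP p).1 hp).2.2.1
    · rw [h, UnbasedLoop.udist_comm]
      exact ((hP q).1 hq).2.2.1
  -- at most `N₀` pairs
  have hcard : P.card ≤ N₀ := by
    have hsub : P.image Prod.fst ⊆ hA.1.toFinset := by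
      intro x hx
      rw [Finset.mem_image] at hx
      obtain ⟨p, hp, rfl⟩ := hx
      rw [Set.Finite.mem_toFinset]
      exact (hrel p hp).1
    calc P.card = (P.image Prod.fst).card := (Finset.card_image_of_injOn hinj1).symm
      _ ≤ hA.1.toFinset.card := Finset.card_le_card hsub
      _ = Set.ncard _ := (Set.ncard_eq_toFinset_card _ hA.1).symm
      _ ≤ N₀ := hA.2
  -- every contributing loop is matched
  have hcov1 : ∀ x ∈ c.loops, (x.range ∩ closedBall (0 : ℂ) R).Nonempty → η / 2 ≤ diam x.range →
      ∃ p ∈ P, Prod.fst p = x := by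
    intro x hx hxR hxd
    obtain ⟨y, hy, hxy⟩ := cc_exists_partner hclose hwin hη.le hx hxR hxd
    exact ⟨(x, y), (hP _).2 ⟨hx, hy, hxy, Or.inl ⟨hxR, hxd⟩⟩, rfl⟩
  have hcov2 : ∀ y ∈ c'.loops, (y.range ∩ closedBall (0 : ℂ) R).Nonempty → η / 2 ≤ diam y.range →
      ∃ p ∈ P, Prod.snd p = y := by
    intro y hy hyR hyd
    obtain ⟨x, hx, hyx⟩ := cc_exists_partner hclose.symm hwin' hη.le hy hyR hyd
    exact ⟨(x, y), (hP _).2 ⟨hx, hy, by rwa [UnbasedLoop.udist_comm], Or.inr ⟨hyR, hyd⟩⟩, rfl⟩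
  -- thresholds are `≥ η/2`
  have hT : ∀ j : ℕ, η / 2 ≤ η / 2 + ((j : ℝ) + 1) * η / (2 * m) := fun j ↦
    le_add_of_nonneg_right (by positivity)
  -- rewrite both averaged sums as sums over the matched pairs
  have hW : ∀ j : ℕ, ∑ᶠ u ∈ c.bigLoops (η / 2 + ((j : ℝ) + 1) * η / (2 * m)), u.nestingPhase f ^ 2 =
      ∑ p ∈ P, (if η / 2 + ((j : ℝ) + 1) * η / (2 * m) ≤ diam p.1.range then p.1.nestingPhase f ^ 2
        else 0) := fun j ↦
    ela2_finsum_bigLoops_eq_sum hR h0 c P Prod.fst hinj1 (fun p hp ↦ ((hP p).1 hp).1) (hT j) hcov1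
  have hW' : ∀ j : ℕ, ∑ᶠ u ∈ c'.bigLoops (η / 2 + ((j : ℝ) + 1) * η / (2 * m)), u.nestingPhase f ^ 2 =
      ∑ p ∈ P, (if η / 2 + ((j : ℝ) + 1) * η / (2 * m) ≤ diam p.2.range then p.2.nestingPhase f ^ 2
        else 0) := fun j ↦
    ela2_finsum_bigLoops_eq_sum hR h0 c' P Prod.snd hinj2 (fun p hp ↦ ((hP p).1 hp).2.1) (hT j) hcov2
  simp_rw [hW, hW']
  -- the abstract averaging step
  have key := ela2_abs_avg_sub_avg_le P hm hcard
    (fun j p ↦ if η / 2 + ((j : ℝ) + 1) * η / (2 * m) ≤ diam p.1.range then p.1.nestingPhase f ^ 2 else 0)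
    (fun j p ↦ if η / 2 + ((j : ℝ) + 1) * η / (2 * m) ≤ diam p.2.range then p.2.nestingPhase f ^ 2 else 0)
    (K := 2 * (C * volume.real (closedBall (0 : ℂ) R)) * C * τ) (D := 4 * π ^ 2 * C ^ 2 * η ^ 4)
    (by positivity) (by positivity)
    (fun p hp ↦ ela2_sum_abs_sub_le hf hC hR hε hm hmε ((hP p).1 hp).2.2.1
      (hsaus p.1 (hrel p hp).1.1 (hrel p hp).1.2.1 (hrel p hp).1.2.2))
  exact key

end Summit.CriticalPhenomena.CardyFormulaZ2.Cruxes.MagicFormulaT.LineSketch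

end
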